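import Literature.Computability.Complexity.GateEliminationCase81Dispatch
import Literature.Computability.Complexity.GateEliminationDoomedSharp

/-!
# Gate elimination: Case 8.2.2 of Li–Yang's proof of Theorem 4.1 — the xor-reconstruction step

Li–Yang, ECCC TR21-023, §4.1, Case 8.2.2 (p. 31) with the deferred configurations of Case 8.2.5
(pp. 35–40). After the protected substitution `x_k := d` of Case 6 (the situation `K` of
`GateEliminationCase82Sit.lean`: normalized, no troubled gate, `x_j` unprotected and read once),
an ∧-type gate `G` of `K` reads a `2⁺`-gate `I` of the xor-part depending on `x_j`. "We
substitute appropriate constant to `Q` via xor-reconstruction such that `G` is trivialized,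
further degenerating `A`, `B` and `C` … We now assume that the elimination of `B` and `G` does not
increase the potential, and defer the other cases to Case 8.2.5. Hence the net potential increment
is bounded by `2`, which gives `Δμ ≥ 4 - 2α_φ + α_I` for this substitution."

`case8_2_2_K` performs this step inside `K` and returns either

* the generic outcome: a fair circuit computing `f` on a source with one free variable fewer and
  `μ' ≤ μ(K, ∅) - α_I - (4 - 2α_φ)` (the eliminations of `G` and of the path slot `B` preceding
  `I` create no troubled gate, `ΔΦ = 0` each; two more doomed gates — the new home of a second
  wire into `I` and a reader of `G` — are eliminated by Rules 2/3, `ΔΦ ≤ 1` each); or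
* the configuration of **Case 8.2.5.1**: the other wire of `G` is a `3`-variable `x_m` read by
  another ∧-type gate (the gate becoming troubled when `G` is eliminated); or
* the configurations of **Case 8.2.5.2** (the elimination of `B` troubles a gate, necessarily
  through the other input `x_ℓ` of `I`, a variable): either the path has one gate, `I` reads
  `x_j` and `x_ℓ` directly and `x_ℓ` is a `3⁺`-variable (Case 8.2.5.2.1.1), or the path is
  longer and an ∧-type gate reads the path gate preceding `I` together with a variable
  (Cases 8.2.5.2.1.2–5, 8.2.5.2.2).

The three special configurations are mapped back to the original circuit and dispatched in
`GateEliminationCase822.lean`. Everything here is PROVED; no statement of the chain is changed.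

## References

* J. Li, T. Yang, *3.1n − o(n) circuit lower bounds for explicit functions*, STOC 2022
  [LiYang2022]; full version ECCC TR21-023, §2.6, §3.3 (Lemma 3.11), §4.1 (Cases 8.2.2, 8.2.5).
-/

namespace Literature.Computability.Complexity

open Finset

/-- `2δ ≤ 2α_I + (5 - 2α_φ + α_Q)` (the last term of the minimum defining `δ`).
[cite: LiYang2022, Thm. 4.1, §4.1 (Case 8.2.2.1)] -/
theorem two_liYangDelta_le_five (αφ αI αQ : ℝ) :
    2 * liYangDelta αφ αI αQ ≤ 2 * αI + (5 - 2 * αφ + αQ) := by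
  unfold liYangDelta
  have : min (αI / 3) (min (2 - 2 * αφ + αQ) (min (4 - 4 * αφ) (min (3 + αφ) (min (5 - αQ)
      ((5 - 2 * αφ + αQ) / 2))))) ≤ (5 - 2 * αφ + αQ) / 2 :=
    min_le_of_right_le (min_le_of_right_le (min_le_of_right_le (min_le_of_right_le (min_le_right _ _))))
  linarith

namespace Semicircuit

variable {n : ℕ}

/-! ### Small helpers -/

section Helpers

variable {D : Semicircuit n}

/-- No troubled gate: the count is `0`. [folklore] -/
theorem troubledCount_eq_zero_of (h : ∀ T, ¬ D.Troubled T) : D.troubledCount = 0 := by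
  classical
  unfold troubledCount
  rw [card_eq_zero, filter_eq_empty_iff]
  exact fun T _ => h T

/-- No troubled gate: the potential of the empty packing is `0`. [cite: LiYang2022, Def. 3.5] -/
theorem potential_empty_of (h : ∀ T, ¬ D.Troubled T) : D.potential ∅ = 0 := by
  unfold potential
  rw [troubledCount_eq_zero_of h]
  simp

/-- Two distinct readers give out-degree `≥ 2`. [folklore] -/
theorem two_le_fanout_of_ne {k₁ k₂ : Fin D.m} (hk : k₁ ≠ k₂) {a₁ a₂ : Fin 2} {v : Node n D.m}
    (h₁ : D.arg k₁ a₁ = v) (h₂ : D.arg k₂ a₂ = v) : 2 ≤ D.fanout v := by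
  classical
  refine le_trans ?_ (D.card_readers_le_fanout v)
  have hsub : ({k₁, k₂} : Finset (Fin D.m)) ⊆ univ.filter fun k => ∃ a, D.arg k a = v := by
    intro k hk
    rw [mem_insert, mem_singleton] at hk
    rcases hk with rfl | rfl
    · exact mem_filter.mpr ⟨mem_univ _, a₁, h₁⟩
    · exact mem_filter.mpr ⟨mem_univ _, a₂, h₂⟩
  have := card_le_card hsub
  rwa [card_pair hk] at this

/-- The wires of two distinct gates into a node are counted by its out-degree. [folklore] -/
theorem card_filter_add_le_fanout {k₁ k₂ : Fin D.m} (hk : k₁ ≠ k₂) (v : Node n D.m) :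
    (univ.filter fun a : Fin 2 => D.arg k₁ a = v).card + (univ.filter fun a : Fin 2 => D.arg k₂ a = v).card
      ≤ D.fanout v := by
  classical
  unfold fanout
  have := Finset.sum_le_sum_of_subset (f := fun j => (univ.filter fun a : Fin 2 => D.arg j a = v).card)
    (subset_univ ({k₁, k₂} : Finset (Fin D.m)))
  rw [sum_pair hk] at this
  exact this

/-- The set of wires of a gate from its two positions. [folklore] -/
theorem range_arg_eq_pair {k : Fin D.m} {a : Fin 2} {u v : Node n D.m} (h : D.arg k a = u)
    (h' : D.arg k a.rev = v) : Set.range (D.arg k) = {u, v} := by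
  ext w
  simp only [Set.mem_range, Set.mem_insert_iff, Set.mem_singleton_iff]
  constructor
  · rintro ⟨a', rfl⟩
    rcases fin2_eq_or_eq_rev a a' with rfl | rfl
    · exact Or.inl h
    · exact Or.inr h'
  · rintro (rfl | rfl)
    · exact ⟨a, h⟩
    · exact ⟨a.rev, h'⟩

/-- A ⊕-type gate fed by a constant is degenerate: it passes its other input, possibly negated.
[cite: LiYang2022, §3.3 (Rule 3)] -/
theorem liveFn_xor_of_isXorOp {k : Fin D.m} (h : IsXorOp (D.op k)) (a : Fin 2) (b : Bool) :
    ∀ t, D.liveFn k a b t = (t ^^ D.liveFn k a b false) := by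
  obtain ⟨c, hc⟩ := h
  intro t
  unfold liveFn
  obtain rfl | rfl : a = 0 ∨ a = 1 := by fin_cases a <;> simp
  · rw [if_pos rfl, if_pos rfl, hc, hc]; cases b <;> cases t <;> cases c <;> rfl
  · rw [if_neg (by decide), if_neg (by decide), hc, hc]; cases b <;> cases t <;> cases c <;> rfl

end Helpers

/-- **After an elimination creating no troubled gate, from a circuit without troubled gates, the
measure at the empty packing drops by at least `1`** (one gate fewer, no new influential input,
both potentials `0`). [cite: LiYang2022, Lemma 3.11, §4.1 (Case 8.2.2.1: "does not increase the potential")] -/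
theorem ElimDataW.measure_empty_le_of_noTroubled {C : Semicircuit n} {k₀ : Fin C.m}
    {f : (Fin n → ZMod 2) → Bool} {R : RdqSource n} {αφ αI αQ δ : ℝ}
    (E : ElimDataW C k₀ f R αφ αI αQ ∅ δ) (h₀ : ∀ T, ¬ C.Troubled T) (h₁ : ∀ T, ¬ E.C'.Troubled T)
    (hI : 0 ≤ αI) : E.C'.measure αφ αI αQ ∅ R ≤ C.measure αφ αI αQ ∅ R - 1 := by
  classical
  unfold measure
  rw [potential_empty_of h₀, potential_empty_of h₁]
  have hm : (E.C'.m : ℝ) + 1 = C.m := by exact_mod_cast E.m_add_one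
  have hinf : ((E.C'.influential R).card : ℝ) ≤ (C.influential R).card := by
    exact_mod_cast card_le_card (E.influential_subset R)
  nlinarith [mul_le_mul_of_nonneg_left hinf hI]

/-! ### The path minus its last gate -/

namespace XorPath

variable {C : Semicircuit n} {i : Fin n} {I : Fin C.m} (p : C.XorPath i I)

/-- For a path of at least two gates, the last index is a successor. [folklore] -/
theorem last_eq_succ (h : 0 < p.len) : Fin.last p.len = (⟨p.len - 1, by omega⟩ : Fin p.len).succ :=
  Fin.ext (by simp; omega)

/-- The index preceding the last one. [folklore] -/
theorem prev_last_eq (h : 0 < p.len) :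
    p.prev (Fin.last p.len) = (⟨p.len - 1, by omega⟩ : Fin p.len).castSucc := by
  rw [p.last_eq_succ h, prev_succ]

/-- It is not the last index. [folklore] -/
theorem prev_last_ne_last (h : 0 < p.len) : p.prev (Fin.last p.len) ≠ Fin.last p.len := by
  rw [p.prev_last_eq h]
  intro e
  have := congrArg Fin.val e
  simp at this
  omega

/-- The gate preceding `I` on the path is not `I`. [folklore] -/
theorem gate_prev_last_ne (h : 0 < p.len) : p.gate (p.prev (Fin.last p.len)) ≠ I := fun e =>
  p.prev_last_ne_last h ((p.gate_eq_last_iff _).mp e)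

/-- `I` reads the preceding path gate at its path position. [cite: LiYang2022, §2.6] -/
theorem arg_last_pos (h : 0 < p.len) :
    C.arg I (p.pos (Fin.last p.len)) = .gate (p.gate (p.prev (Fin.last p.len))) := by
  rw [p.prev_last_eq h]
  have := p.arg_succ ⟨p.len - 1, by omega⟩
  rw [← p.last_eq_succ h, p.gate_last] at this
  exact this

/-- For a one-gate path, every index is the last one. [folklore] -/
theorem eq_last_of_len_eq_zero (h : p.len = 0) (t : Fin (p.len + 1)) : t = Fin.last p.len :=
  Fin.ext (by have := t.isLt; simp; omega)

/-- **The path without its last gate**: a path from `x_i` to the gate preceding `I`.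
[cite: LiYang2022, §2.6] -/
def dropLast (h : 0 < p.len) : C.XorPath i (p.gate (p.prev (Fin.last p.len))) where
  len := p.len - 1
  gate j := p.gate (j.castLE (by omega))
  pos j := p.pos (j.castLE (by omega))
  gate_last := by
    rw [p.prev_last_eq h]
    congr 1
  mem_xorPart j := p.mem_xorPart _
  arg_zero := by
    have h0 : (0 : Fin (p.len - 1 + 1)).castLE (by omega : p.len - 1 + 1 ≤ p.len + 1) = 0 := Fin.ext rfl
    rw [h0]
    exact p.arg_zero
  arg_succ j := by
    have h1 : j.succ.castLE (by omega : p.len - 1 + 1 ≤ p.len + 1) =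
        (j.castLE (by omega : p.len - 1 ≤ p.len)).succ := Fin.ext rfl
    have h2 : j.castSucc.castLE (by omega : p.len - 1 + 1 ≤ p.len + 1) =
        (j.castLE (by omega : p.len - 1 ≤ p.len)).castSucc := Fin.ext rfl
    rw [h1, h2]
    exact p.arg_succ _
  injective a b hab := Fin.ext (by simpa using congrArg Fin.val (p.injective hab))

/-- Its length. [folklore] -/
@[simp] theorem dropLast_len (h : 0 < p.len) : (p.dropLast h).len = p.len - 1 := rfl

end XorPath

/-! ### The xor-reconstruction step of Case 8.2.2 -/

section Main

variable {C : Semicircuit n} {f : (Fin n → ZMod 2) → Bool} {R : RdqSource n} {d : ℕ} {αφ αI αQ : ℝ}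

/-- **Case 8.2.2 of Li–Yang's proof of Theorem 4.1, the second substitution, inside the circuit
`K` after `x_k := d`** (fair, normalized, no troubled gate, computing `f|_R` with
`dim R ≥ 2d + 2`): `G` is an ∧-type gate reading at `aI` a `2⁺`-gate `I` of the xor-part which
depends on the unprotected `1`-variable `x` (path `p` from `x` to `I`), the other wire of `G` not
an ∧-type gate. The xor-reconstruction `I := b` trivializing `G` (`Δμ ≥ α_I`) is followed by
the eliminations of `G` (Rule 2) and of the path slot `B` preceding `I`, now fed by `b` (Rule 3).
Either both create no troubled gate — then two more doomed gates (the new home of a second wire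
into `I`, a reader of `G`; if these coincide, a second reader of the non-useless `G`; if `I` read
itself, the path gate reading the doubly-constant `B`) are eliminated by Rules 2/3 and
`μ' ≤ μ(K, ∅) - α_I - (4 - 2α_φ)` on a source with one free variable fewer ("the net potential
increment is bounded by `2`, which gives `Δμ ≥ 4 - 2α_φ + α_I`") — or one of the configurations
of Case 8.2.5 is present in `K`: (8.2.5.1) the other wire of `G` is a `3`-variable `x_m` read by
another ∧-type gate; (8.2.5.2, one-gate path) `I` reads besides `x` a `3⁺`-variable `x_ℓ`;
(8.2.5.2, longer path) an ∧-type gate reads the path gate preceding `I` and a variable, the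
other input of `I` being a variable `x_ℓ ≠ x`.
[cite: LiYang2022, §4.1 (Cases 8.2.2.1, 8.2.5, 8.2.5.1, 8.2.5.2), §2.6, Lemma 3.11] -/
theorem case8_2_2_K (hf : IsAffineDisperser f d) (hd : 2 * d + 2 ≤ R.dim) (hF : C.Fair)
    (hC : C.ComputesRestr f R) (hN : C.Normalized) (hT : ∀ T, ¬ C.Troubled T)
    (hφ : 0 ≤ αφ) (hI : 0 ≤ αI) (αQ : ℝ)
    {G I : Fin C.m} {aI : Fin 2} (hand : IsAndOp (C.op G)) (hGI : C.arg G aI = .gate I)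
    (hw : ∀ k, C.arg G aI.rev = .gate k → ¬ IsAndOp (C.op k))
    {x : Fin n} (p : C.XorPath x I) (hdep : C.DependsOn hF I x) (hxp : ¬ R.Protected x)
    (hx1 : C.fanout (.var x) = 1) (hI2 : 2 ≤ C.fanout (.gate I)) :
    (∃ (C' : Semicircuit n) (R' : RdqSource n) (P' : Finset (Fin C'.m × Fin C'.m)),
        C'.Fair ∧ C'.ComputesRestr f R' ∧ C'.IsPacking P' ∧ R'.dim + 1 = R.dim ∧
        C'.measure αφ αI αQ P' R' ≤ C.measure αφ αI αQ ∅ R - αI - (4 - 2 * αφ)) ∨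
    (∃ (xm : Fin n) (T : Fin C.m) (aT : Fin 2), C.arg G aI.rev = .var xm ∧ C.fanout (.var xm) = 3 ∧
        T ≠ G ∧ IsAndOp (C.op T) ∧ C.arg T aT = .var xm) ∨
    (p.len = 0 ∧ ∃ xl : Fin n, p.other (Fin.last p.len) = .var xl ∧ xl ≠ x ∧ 3 ≤ C.fanout (.var xl)) ∨
    (0 < p.len ∧ ∃ (T : Fin C.m) (aT : Fin 2) (t xl : Fin n), T ≠ G ∧ IsAndOp (C.op T) ∧
        C.arg T aT = .gate (p.gate (p.prev (Fin.last p.len))) ∧ C.arg T aT.rev = .var t ∧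
        p.other (Fin.last p.len) = .var xl ∧ xl ≠ x) := by
  classical
  have hPN : C.PreNormalized := hN.1
  have hGK : G ∉ C.xorPart := C.not_mem_xorPart_of_isAndOp hand
  have hGoff := p.gate_ne_of_isAndOp hand
  have hGIne : G ≠ I := fun e => hGK (e ▸ p.last_mem_xorPart)
  obtain ⟨b, hb⟩ := exists_trivializing hand aI
  obtain ⟨P', hF', hC', hP', hdim, -, -, hμP'⟩ :=
    C.xor_reconstruction hF hC C.isPacking_empty p hdep hxp b hφ hI αQ
  have hd₂ : 2 * d + 1 ≤ (C.rerouteSource hF b hC p hxp).dim := by omega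
  -- no troubled gates after the reconstruction; the measure at the empty packing
  have hT' : ∀ T, ¬ (C.reroute p b).Troubled T := fun T h => hT T (troubled_of_troubled_reroute p b h).1
  have hμ' : (C.reroute p b).measure αφ αI αQ ∅ (C.rerouteSource hF b hC p hxp) ≤
      C.measure αφ αI αQ ∅ R - αI := by
    refine le_trans ?_ hμP'
    unfold measure
    rw [potential_empty_of hT']
    have := (C.reroute p b).potential_nonneg hP'
    nlinarith [mul_le_mul_of_nonneg_left this hφ]
  -- `G` reads the constant `b` and is trivialized
  have h₀ : (C.reroute p b).arg G aI = .const b := reroute_arg_reader p b hand hGI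
  have htriv' : (C.reroute p b).liveFn G aI b false = (C.reroute p b).liveFn G aI b true := by
    rw [liveFn_reroute_reader p b hand]; exact hb
  have hout' : (C.reroute p b).out ≠ .gate G := out_ne_of_trivialized hf (by omega) hF' hC' h₀ htriv'
  have hsyn : (C.reroute p b).SynVal (.gate G) ((C.reroute p b).liveFn G aI b false) :=
    SynVal.of_trivialized _ h₀ htriv'
  have hGw' : (C.reroute p b).arg G aI.rev = (C.arg G aI.rev).reroute x I b :=
    reroute_arg_reader_rev p b hand _
  -- Rule 2 on `G`
  let E₁ := elimDataWTriv hF' hC' (C.reroute p b).isPacking_empty h₀ htriv' hout' hφ hI αQ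
  have hrepl₁ : E₁.repl = .const ((C.reroute p b).liveFn G aI b false) := rfl
  ------------------------------------------------------------------------------------------
  -- the elimination of `G` creates a troubled gate: Case 8.2.5.1
  by_cases h1 : ∃ T, E₁.C'.Troubled T
  · obtain ⟨T, hTT⟩ := h1
    obtain ⟨a, ha⟩ := E₁.causedBy_of_new_troubled T hTT (hT' _)
    have haI : a = aI.rev := by
      rcases fin2_eq_or_eq_rev aI a with rfl | rfl
      · rw [h₀] at ha; exact absurd ha not_causedBy_const
      · rfl
    rw [haI, hGw'] at ha
    have hTand : IsAndOp (E₁.C'.op T) := hTT.exists_wires.1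
    have hT₀and : IsAndOp ((C.reroute p b).op (E₁.ι T)) := (E₁.isAndOp_iff T).mp hTand
    have hT₀off := not_mem_of_isAndOp p b hT₀and
    have hT₀andC : IsAndOp (C.op (E₁.ι T)) := by
      rwa [reroute_op_of_not_mem p b hT₀off] at hT₀and
    rcases ha with hgate | ⟨z, hz, aT, haT⟩
    · -- `G` read the ∧-type gate that becomes troubled: excluded
      exfalso
      have hTI : E₁.ι T ≠ I := ne_last_of_not_mem p hT₀off
      exact hw _ ((Node.reroute_eq_gate_iff_of_ne x I b hTI).mp hgate) hT₀andC
    · -- `G` read the variable `z`, now of out-degree `3`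
      obtain ⟨hGz, hzx⟩ := (Node.reroute_eq_var_iff x I b).mp hz
      have hTz : C.arg (E₁.ι T) aT = .var z := by
        rcases (E₁.arg_eq_var_iff T aT z).mp haT with h | ⟨-, h⟩
        · rw [reroute_arg_of_not_mem p b hT₀off] at h
          exact ((Node.reroute_eq_var_iff x I b).mp h).1
        · rw [hrepl₁] at h; cases h
      obtain ⟨aT', y, -, haT', -, hfz, -⟩ := hTT.exists_wires_of_reads ⟨aT, haT⟩
      have hfz' : (C.reroute p b).fanout (.var z) = 3 := by
        have h1 := E₁.fanout_var_add (i := z) (by rw [hrepl₁]; exact fun h => by cases h)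
        have h2 : (univ.filter fun a : Fin 2 => (C.reroute p b).arg G a = .var z).card = 1 := by
          rw [card_eq_one]
          refine ⟨aI.rev, ?_⟩
          ext a'
          rw [mem_filter, mem_singleton]
          constructor
          · rintro ⟨-, h⟩
            rcases fin2_eq_or_eq_rev aI a' with rfl | rfl
            · rw [h₀] at h; cases h
            · rfl
          · rintro rfl
            exact ⟨mem_univ _, by rw [hGw', hGz, Node.reroute_var_of_ne x I b hzx]⟩
        omega
      have hfzC : C.fanout (.var z) = 3 := by
        rw [← fanout_reroute_of_generic p b (v := .var z) (fun e => hzx (Node.var.inj e)) (by simp) (by simp)]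
        exact hfz'
      exact Or.inr (Or.inl ⟨z, E₁.ι T, aT, hGz, hfzC, E₁.ι_ne T, hT₀andC, hTz⟩)
  ------------------------------------------------------------------------------------------
  push Not at h1
  have hμ₁ : E₁.C'.measure αφ αI αQ ∅ (C.rerouteSource hF b hC p hxp) ≤
      (C.reroute p b).measure αφ αI αQ ∅ (C.rerouteSource hF b hC p hxp) - 1 :=
    E₁.measure_empty_le_of_noTroubled hT' h1 hI
  -- the path slot `B` preceding `I`, reading the constant `b` at wire `0`
  have hB0 : (C.reroute p b).arg (p.gate (p.prev (Fin.last p.len))) 0 = .const b :=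
    reroute_arg_prev_last_zero p b
  have hBK : p.gate (p.prev (Fin.last p.len)) ∈ C.xorPart := p.mem_xorPart _
  have hBG : p.gate (p.prev (Fin.last p.len)) ≠ G := hGoff _
  obtain ⟨B₁, hB₁⟩ := E₁.ι_surj _ hBG
  have hB₁0 : E₁.C'.arg B₁ 0 = .const b :=
    (E₁.arg_eq_const_iff B₁ 0 b).mpr (Or.inl (by rw [hB₁]; exact hB0))
  have hB₁K : B₁ ∈ E₁.C'.xorPart := (E₁.mem_xorPart_iff B₁).mpr (by rw [hB₁]; exact hBK)
  -- its other wire: the other input of `I`, rerouted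
  have hB1' : (C.reroute p b).arg (p.gate (p.prev (Fin.last p.len))) 1 =
      (p.other (Fin.last p.len)).reroute x I b := by
    rw [reroute_arg_gate_one, p.next_prev]
  have hBnotG : (C.reroute p b).arg (p.gate (p.prev (Fin.last p.len))) 1 ≠ .gate G := fun h =>
    hGK ((C.reroute p b).mem_of_arg_eq _ hBK 1 G h)
  have hB₁1 : (E₁.C'.arg B₁ 1).embed E₁.ι = (p.other (Fin.last p.len)).reroute x I b := by
    rw [E₁.arg_eq, hB₁, if_neg hBnotG, hB1']
  -- Rule 3 on `B₁`
  have hdegB := liveFn_xor_of_isXorOp (E₁.C'.isXorOp_of_mem B₁ hB₁K) (0 : Fin 2) b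
  have houtB : E₁.C'.out ≠ .gate B₁ := out_ne_gate_of_mem_xorPart hf hd₂ E₁.fair E₁.computes hB₁K
  let E₂ := elimDataWBypass E₁.fair E₁.computes E₁.C'.isPacking_empty _ hB₁0 hdegB houtB hφ hI αQ
  have hrepl₂ : E₂.repl = E₁.C'.arg B₁ 1 := rfl
  ------------------------------------------------------------------------------------------
  -- the elimination of `B₁` creates a troubled gate: Case 8.2.5.2
  by_cases h2 : ∃ T, E₂.C'.Troubled T
  · obtain ⟨T, hTT⟩ := h2
    obtain ⟨a, ha⟩ := E₂.causedBy_of_new_troubled T hTT (h1 _)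
    have ha1 : a = 1 := by
      rcases fin2_eq_or_eq_rev (0 : Fin 2) a with rfl | rfl
      · rw [hB₁0] at ha; exact absurd ha not_causedBy_const
      · rfl
    rw [ha1] at ha
    have hT₁and : IsAndOp (E₁.C'.op (E₂.ι T)) := (E₂.isAndOp_iff T).mp hTT.exists_wires.1
    rcases ha with hgate | ⟨xl, hxl, aT₀, haT₀⟩
    · -- `B₁` read an ∧-type gate: excluded, the xor-part is closed
      exfalso
      have hmem : E₂.ι T ∈ E₁.C'.xorPart := E₁.C'.mem_of_arg_eq B₁ hB₁K 1 _ hgate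
      exact not_isAndOp_of_isXorOp (E₁.C'.isXorOp_of_mem _ hmem) hT₁and
    · -- `B₁` read the variable `x_l`, which troubles `T`
      have hother : p.other (Fin.last p.len) = .var xl ∧ xl ≠ x := by
        have h := hB₁1
        rw [hxl] at h
        exact (Node.reroute_eq_var_iff x I b).mp h.symm
      obtain ⟨aT, t, htl, haTl, haTt, hfl, hft⟩ := hTT.exists_wires_of_reads ⟨aT₀, haT₀⟩
      have hTf : E₂.C'.fanout (.gate T) = 1 := hTT.exists_wires.2.1
      have hT₁B : E₂.ι T ≠ B₁ := E₂.ι_ne T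
      -- the second wire of `E₂.ι T` is the variable `t`, in `E₁.C'`, `C.reroute p b` and `C`
      have hT₁t : E₁.C'.arg (E₂.ι T) aT.rev = .var t := by
        rcases (E₂.arg_eq_var_iff T aT.rev t).mp haTt with h | ⟨-, h⟩
        · exact h
        · exfalso
          rw [hrepl₂, hxl] at h
          exact htl (Node.var.inj h).symm
      have hT'and' : IsAndOp ((C.reroute p b).op (E₁.ι (E₂.ι T))) := (E₁.isAndOp_iff _).mp hT₁and
      have hT'off := not_mem_of_isAndOp p b hT'and'
      have hT'and : IsAndOp (C.op (E₁.ι (E₂.ι T))) := by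
        rwa [reroute_op_of_not_mem p b hT'off] at hT'and'
      have hT't' : (C.reroute p b).arg (E₁.ι (E₂.ι T)) aT.rev = .var t := by
        rcases (E₁.arg_eq_var_iff (E₂.ι T) aT.rev t).mp hT₁t with h | ⟨-, h⟩
        · exact h
        · rw [hrepl₁] at h; cases h
      have hT't : C.arg (E₁.ι (E₂.ι T)) aT.rev = .var t := by
        rw [reroute_arg_of_not_mem p b hT'off] at hT't'
        exact ((Node.reroute_eq_var_iff x I b).mp hT't').1
      -- the first wire of `E₂.ι T`: `x_l` itself, or `B₁`
      rcases (E₂.arg_eq_var_iff T aT xl).mp haTl with hdirect | ⟨hvia, -⟩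
      · ---- `T` read `x_l` directly: `B₁` is a `0`-gate and `x_l` a `3`-variable (8.2.5.2.1.1)
        have hsum : E₁.C'.fanout (.var xl) + E₁.C'.fanout (.gate B₁) = 3 := by
          have h := E₂.fanout_repl_add
          rw [hrepl₂, hxl] at h
          have hpull : E₂.pull (.var xl) = .var xl := rfl
          have hone : (univ.filter fun a : Fin 2 => E₁.C'.arg B₁ a = .var xl).card = 1 := by
            rw [card_eq_one]
            refine ⟨1, ?_⟩
            ext a'
            rw [mem_filter, mem_singleton]
            constructor
            · rintro ⟨-, h'⟩
              rcases fin2_eq_or_eq_rev (0 : Fin 2) a' with rfl | rfl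
              · rw [hB₁0] at h'; cases h'
              · rfl
            · rintro rfl; exact ⟨mem_univ _, hxl⟩
          rw [hpull, hone, hfl] at h
          omega
        have h2le : 2 ≤ E₁.C'.fanout (.var xl) := two_le_fanout_of_ne hT₁B hdirect hxl
        -- `x_l` is not a `2`-variable of `E₁.C'`, else `E₂.ι T` was troubled there
        have hne2 : E₁.C'.fanout (.var xl) ≠ 2 := by
          intro h2'
          refine h1 (E₂.ι T) ⟨hT₁and, ?_, xl, t, htl.symm, range_arg_eq_pair hdirect hT₁t, h2', ?_⟩
          · have h := E₂.fanout_gate_add (k' := T) (by rw [hrepl₂, hxl]; exact fun h => by cases h)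
            have h0 : (univ.filter fun a : Fin 2 => E₁.C'.arg B₁ a = .gate (E₂.ι T)).card = 0 := by
              rw [card_eq_zero, filter_eq_empty_iff]
              intro a' _ h'
              rcases fin2_eq_or_eq_rev (0 : Fin 2) a' with rfl | rfl
              · rw [hB₁0] at h'; cases h'
              · exact absurd (hxl.symm.trans h') (by simp)
            rw [h0, hTf] at h
            omega
          · have h := E₂.fanout_var_add (i := t) (by rw [hrepl₂, hxl]; exact fun h => htl (Node.var.inj h).symm)
            have h0 : (univ.filter fun a : Fin 2 => E₁.C'.arg B₁ a = .var t).card = 0 := by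
              rw [card_eq_zero, filter_eq_empty_iff]
              intro a' _ h'
              rcases fin2_eq_or_eq_rev (0 : Fin 2) a' with rfl | rfl
              · rw [hB₁0] at h'; cases h'
              · exact htl (Node.var.inj (hxl.symm.trans h')).symm
            rw [h0, hft] at h
            omega
        have hfl3 : E₁.C'.fanout (.var xl) = 3 := by omega
        have hfB : E₁.C'.fanout (.gate B₁) = 0 := by omega
        -- hence the path has one gate: otherwise the path slot before `B` reads `B`
        have hlen : p.len = 0 := by
          by_contra hlen
          have hpos : 0 < p.len := Nat.pos_of_ne_zero hlen
          have hBI : p.gate (p.prev (Fin.last p.len)) ≠ I := p.gate_prev_last_ne hpos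
          have hRB : (C.reroute p b).arg (p.gate (p.prev (p.prev (Fin.last p.len)))) 0 =
              .gate (p.gate (p.prev (Fin.last p.len))) := by
            rw [reroute_arg_gate_zero, p.next_prev, Node.reroute_gate_of_ne x I b hBI]
          obtain ⟨j', hj'⟩ := E₁.ι_surj (p.gate (p.prev (p.prev (Fin.last p.len)))) (hGoff _)
          have hj'B : E₁.C'.arg j' 0 = .gate B₁ :=
            (E₁.arg_eq_gate_iff j' 0 B₁).mpr (Or.inl (by rw [hj', hB₁]; exact hRB))
          have := fanout_pos_of_arg_eq hj'B
          omega
        -- and `x_l` is a `3⁺`-variable of `C`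
        have hflC : 3 ≤ C.fanout (.var xl) := by
          have h := E₁.fanout_var_add (i := xl) (by rw [hrepl₁]; exact fun h => by cases h)
          rw [← fanout_reroute_of_generic p b (v := .var xl) (fun e => hother.2 (Node.var.inj e))
            (by simp) (by simp)]
          omega
        exact Or.inr (Or.inr (Or.inl ⟨hlen, xl, hother.1, hother.2, hflC⟩))
      · ---- `T` read `B₁`: an ∧-type gate of `C` reads the path gate before `I` (8.2.5.2.1.2–5, 8.2.5.2.2)
        have hT'B' : (C.reroute p b).arg (E₁.ι (E₂.ι T)) aT = .gate (p.gate (p.prev (Fin.last p.len))) := by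
          rcases (E₁.arg_eq_gate_iff (E₂.ι T) aT B₁).mp hvia with h | ⟨-, h⟩
          · rw [hB₁] at h; exact h
          · rw [hrepl₁] at h; cases h
        rw [reroute_arg_of_not_mem p b hT'off] at hT'B'
        -- the path has at least two gates: otherwise `T` would read `x`
        have hpos : 0 < p.len := by
          by_contra hlen
          push Not at hlen
          have hlen0 : p.len = 0 := by omega
          have hBI : p.gate (p.prev (Fin.last p.len)) = I := by
            rw [p.eq_last_of_len_eq_zero hlen0 (p.prev (Fin.last p.len)), p.gate_last]
          rw [hBI] at hT'B'
          have hTx : C.arg (E₁.ι (E₂.ι T)) aT = .var x := (Node.reroute_eq_gate_self_iff x I b).mp hT'B'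
          have := eq_of_arg_eq_of_fanout_eq_one hPN.arg_zero_ne_arg_one hx1 hTx p.arg_zero
          exact hT'off 0 this.symm
        have hBI : p.gate (p.prev (Fin.last p.len)) ≠ I := p.gate_prev_last_ne hpos
        have hT'B : C.arg (E₁.ι (E₂.ι T)) aT = .gate (p.gate (p.prev (Fin.last p.len))) :=
          (Node.reroute_eq_gate_iff_of_ne x I b hBI).mp hT'B'
        refine Or.inr (Or.inr (Or.inr ⟨hpos, E₁.ι (E₂.ι T), aT, t, xl, E₁.ι_ne _, hT'and, hT'B, hT't,
          hother.1, hother.2⟩))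
  ------------------------------------------------------------------------------------------
  push Not at h2
  have hμ₂ : E₂.C'.measure αφ αI αQ ∅ (C.rerouteSource hF b hC p hxp) ≤
      E₁.C'.measure αφ αI αQ ∅ (C.rerouteSource hF b hC p hxp) - 1 :=
    E₂.measure_empty_le_of_noTroubled h1 h2 hI
  -- `G` is not the output of `C`; its readers
  have houtC : C.out ≠ .gate G := by
    intro h
    apply hout'
    rw [reroute_out, h, Node.reroute_gate_of_ne x I b hGIne]
  have hreaderG : ∀ {H : Fin C.m} {aH : Fin 2}, C.arg H aH = .gate G →
      (∀ j, p.gate j ≠ H) ∧ (C.reroute p b).arg H aH = .gate G ∧ H ∈ (C.reroute p b).doomed ∧ H ≠ G ∧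
        H ∉ C.xorPart := by
    intro H aH hHG
    have hHK : H ∉ C.xorPart := fun hHK => hGK (C.mem_of_arg_eq H hHK aH G hHG)
    have hHoff : ∀ j, p.gate j ≠ H := fun j e => hHK (e ▸ p.mem_xorPart j)
    have hHG' : (C.reroute p b).arg H aH = .gate G := by
      rw [reroute_arg_of_not_mem p b hHoff, hHG, Node.reroute_gate_of_ne x I b hGIne]
    exact ⟨hHoff, hHG', mem_doomed_of_reads _ hHG' hsyn, fun e => C.arg_ne_self_of_not_mem hGK aH (e ▸ hHG), hHK⟩
  obtain ⟨H, aH, hHG⟩ : ∃ (H : Fin C.m) (aH : Fin 2), C.arg H aH = .gate G := by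
    by_contra hno
    push Not at hno
    exact houtC (hPN.out_of_fanout_eq_zero G ((fanout_eq_zero_iff C _).mpr hno))
  obtain ⟨hHoff, -, hHdoom, hHG', hHK⟩ := hreaderG hHG
  have hHB : H ≠ p.gate (p.prev (Fin.last p.len)) := fun e => hHK (e ▸ hBK)
  -- two doomed gates other than `G` and `B`
  have hXY : ∃ X Y : Fin C.m, X ∈ (C.reroute p b).doomed ∧ Y ∈ (C.reroute p b).doomed ∧ X ≠ Y ∧
      X ≠ G ∧ X ≠ p.gate (p.prev (Fin.last p.len)) ∧ Y ≠ G ∧ Y ≠ p.gate (p.prev (Fin.last p.len)) := by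
    obtain ⟨A, aA, hAG, hAI⟩ := exists_other_reader hPN.arg_zero_ne_arg_one hI2 G
    by_cases hAoff : ∀ j, p.gate j ≠ A
    · -- `A` off the path now reads `b`
      have hAb : (C.reroute p b).arg A aA = .const b := reroute_arg_eq_const_of_eq_gate_last p b hAoff hAI
      have hAdoom : A ∈ (C.reroute p b).doomed := mem_doomed_of_const _ hAb
      have hAB : A ≠ p.gate (p.prev (Fin.last p.len)) := fun e => hAoff _ e.symm
      by_cases hHA : H = A
      · subst hHA
        -- `H` reads `G` and `I`: as `G` is not useless, it has a second reader
        have hG2 : 2 ≤ C.fanout (.gate G) := by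
          by_contra hlt
          have h1' : C.fanout (.gate G) = 1 := by
            have := fanout_pos_of_arg_eq hHG; omega
          refine hN.2 G ⟨h1', H, aH, aI, hHG'.symm, hHG, ?_⟩
          have haa : aA = aH.rev := by
            rcases fin2_eq_or_eq_rev aH aA with e | e
            · rw [e, hHG] at hAI; cases hAI; exact absurd rfl hGIne
            · exact e
          rw [← haa, hAI, hGI]
        obtain ⟨H₂, a₂, hH₂, hH₂G⟩ := exists_other_reader hPN.arg_zero_ne_arg_one hG2 H
        obtain ⟨-, -, hH₂doom, hH₂G', hH₂K⟩ := hreaderG hH₂G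
        exact ⟨H, H₂, hAdoom, hH₂doom, fun e => hH₂ e.symm, hHG', hAB, hH₂G', fun e => hH₂K (e ▸ hBK)⟩
      · exact ⟨A, H, hAdoom, hHdoom, fun e => hHA e.symm, hAG, hAB, hHG', hHB⟩
    · -- `A = p.gate t` on the path reads `I` as its other input
      push Not at hAoff
      obtain ⟨t, rfl⟩ := hAoff
      have hother : p.other t = .gate I := by
        rcases p.arg_eq_src_or_other t aA with ⟨-, he⟩ | ⟨-, he⟩
        · exact absurd (he.symm.trans hAI) (p.src_ne_gate_last t)
        · exact he.symm.trans hAI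
      by_cases ht : t = Fin.last p.len
      · -- `I` reads itself: `B` reads `b` twice; its reader on the reversed path is doomed
        subst ht
        have hB1b : (C.reroute p b).arg (p.gate (p.prev (Fin.last p.len))) 1 = .const b := by
          rw [hB1', hother, Node.reroute_gate_self]
        have hBsyn : (C.reroute p b).SynVal (.gate (p.gate (p.prev (Fin.last p.len))))
            ((C.reroute p b).op (p.gate (p.prev (Fin.last p.len))) b b) :=
          SynVal.both (hB0 ▸ SynVal.const b) (hB1b ▸ SynVal.const b) rfl
        by_cases hlen : p.len = 0
        · -- a one-gate path: `I` reads `x` and itself, contradicting fairness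
          exfalso
          have h0 : (0 : Fin (p.len + 1)) = Fin.last p.len := p.eq_last_of_len_eq_zero hlen 0
          have hIx : C.arg I (p.pos (Fin.last p.len)) = .var x := by
            have h := p.arg_zero
            rw [h0, p.gate_last] at h
            exact h
          have hII : C.arg I (p.pos (Fin.last p.len)).rev = .gate I := by
            have h := hother
            unfold XorPath.other at h
            rw [p.gate_last] at h
            exact h
          exact hF.not_reads_self_of_var hIx _ hII
        · have hpos : 0 < p.len := Nat.pos_of_ne_zero hlen
          have hBI : p.gate (p.prev (Fin.last p.len)) ≠ I := p.gate_prev_last_ne hpos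
          have hRB : (C.reroute p b).arg (p.gate (p.prev (p.prev (Fin.last p.len)))) 0 =
              .gate (p.gate (p.prev (Fin.last p.len))) := by
            rw [reroute_arg_gate_zero, p.next_prev, Node.reroute_gate_of_ne x I b hBI]
          have hRBdoom := mem_doomed_of_reads _ hRB hBsyn
          have hRBB : p.gate (p.prev (p.prev (Fin.last p.len))) ≠ p.gate (p.prev (Fin.last p.len)) := by
            intro e
            have h1 := p.injective e
            have h2 := congrArg p.next h1
            rw [XorPath.next_prev, XorPath.next_prev] at h2
            exact p.prev_last_ne_last hpos h2
          exact ⟨_, H, hRBdoom, hHdoom, fun e => hHoff _ e, hGoff _, hRBB, hHG', hHB⟩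
      · -- the preceding slot inherits the wire to `I`, now the constant `b`
        have hA'b : (C.reroute p b).arg (p.gate (p.prev t)) 1 = .const b := by
          rw [reroute_arg_gate_one, XorPath.next_prev, hother, Node.reroute_gate_self]
        have hA'doom := mem_doomed_of_const _ hA'b
        have hA'B : p.gate (p.prev t) ≠ p.gate (p.prev (Fin.last p.len)) := by
          intro e
          have h1 := p.injective e
          apply ht
          have h2 := congrArg p.next h1
          rwa [XorPath.next_prev, XorPath.next_prev] at h2
        exact ⟨_, H, hA'doom, hHdoom, fun e => hHoff _ e, hGoff _, hA'B, hHG', hHB⟩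
  -- transport them through the two eliminations and eliminate them (Rules 2/3, `ΔΦ ≤ 1` each)
  obtain ⟨X, Y, hXd, hYd, hXY, hXG, hXB, hYG, hYB⟩ := hXY
  obtain ⟨X₁, hX₁⟩ := E₁.ι_surj X hXG
  obtain ⟨Y₁, hY₁⟩ := E₁.ι_surj Y hYG
  have hX₁d : X₁ ∈ E₁.C'.doomed := E₁.doomed_of X₁ (by rw [hX₁]; exact hXd)
  have hY₁d : Y₁ ∈ E₁.C'.doomed := E₁.doomed_of Y₁ (by rw [hY₁]; exact hYd)
  have hX₁B : X₁ ≠ B₁ := fun e => hXB (by rw [← hX₁, e, hB₁])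
  have hY₁B : Y₁ ≠ B₁ := fun e => hYB (by rw [← hY₁, e, hB₁])
  obtain ⟨X₂, hX₂⟩ := E₂.ι_surj X₁ hX₁B
  obtain ⟨Y₂, hY₂⟩ := E₂.ι_surj Y₁ hY₁B
  have hX₂d : X₂ ∈ E₂.C'.doomed := E₂.doomed_of X₂ (by rw [hX₂]; exact hX₁d)
  have hY₂d : Y₂ ∈ E₂.C'.doomed := E₂.doomed_of Y₂ (by rw [hY₂]; exact hY₁d)
  have hX₂Y₂ : X₂ ≠ Y₂ := by
    intro e
    apply hXY
    rw [← hX₁, ← hY₁, ← hX₂, ← hY₂, e]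
  have h2card : 2 ≤ E₂.C'.doomed.card := by
    have hsub : ({X₂, Y₂} : Finset (Fin E₂.C'.m)) ⊆ E₂.C'.doomed := by
      intro k hk
      rw [mem_insert, mem_singleton] at hk
      rcases hk with rfl | rfl
      · exact hX₂d
      · exact hY₂d
    have := card_le_card hsub
    rwa [card_pair hX₂Y₂] at this
  obtain ⟨D', P'', hFD, hCD, hPD, -, hμD⟩ :=
    cascade_doomed' hf hd₂ hφ hI αQ 2 E₂.C' ∅ E₂.fair E₂.computes E₂.C'.isPacking_empty h2card
  refine Or.inl ⟨D', C.rerouteSource hF b hC p hxp, P'', hFD, hCD, hPD, hdim, ?_⟩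
  push_cast at hμD
  linarith

end Main

end Semicircuit

end Literature.Computability.Complexity
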